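/-
Copyright: public-audit package `pub-balaban` (b2b-balaban), seat pv09-g4. Released under Apache 2.0 like Mathlib.
-/
import Literature.MathematicalPhysics.QuantumFieldTheory.Balaban1983to89.B6LayerOptimal

/-!
# B6, p. 245: the Neumann eigenfunction — no layer constant above 4L sin²(π/2L) (< π²/L), in any dimension

Source under audit: T. Bałaban, *Propagators and renormalization transformations for lattice gauge theories.
II*, Commun. Math. Phys. **96** (1984) 223–250 [B6], proof of Lemma 2.4, p. 245.  Companion of the layer chain
`B6LayerPoincare` → … → `B6LayerTensor` (`LayerIneq d L κ ↔ PathIneq L κ`, `LayerIneq d L 1 ↔ L ≤ 9`) → `B6LayerWindow`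
(8/L admissible) → `B6LayerOptimal` (`kappaOpt d L`, attained, `LayerIneq d L κ ↔ κ ≤ kappaOpt d L`): all imported untouched.

## The printed sentence (verbatim, p. 245, between (2.126) and (2.127))

*"The terms in parentheses on the right-hand side can be written as L^{−2}⟨B, (Δ_{Δ′}^{L^{−1},N} +
Q′*_{Δ′}Q′_{Δ′})B⟩, where the operators are defined on a d − 1-dimensional lattice.  This quadratic form is
bounded from below by L^{−d−1} Σ_{x∈Δ′} |B_μ(x)|², hence"* [(2.127) follows].  (Same quotation as in
the companions; copied from `B6LayerOptimal`.)  The sentence is `LayerIneq d L 1`.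

## What this file proves (all [folklore]; nothing printed is asserted or used)

The upper end of the window of `B6LayerOptimal` (κ_opt ≤ 12/(L+1), from piecewise-linear test functions in
`B6LayerUpperBound`) is replaced by the SHARP one, with the classical test function of the free-boundary path:
u(a) = cos(π(2a+1)/(2L)), a ∈ [0, L) (`cosTest`).

* §1 `dirichlet_eq_of_eigen` — a discrete Green identity: if u(a−1) + u(a+1) = c·u(a) for all a and the ghost
  values reflect (u(−1) = u(0), u(M+1) = u(M)), then Σ_{s<M} (u(s+1) − u(s))² = (2 − c)·Σ_{s≤M} u(s)².
* §2 the cosine profile: `cosTest_eigen` (c = 2cos(π/L)), `cosTest_ghost_left/right`, `cosTest_reflect`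
  (u(L−1−a) = −u(a)), hence `sum_cosTest` (Σ u = 0) — no closed-form trigonometric sums are needed — and
  `cosTest_zero_pos` (u(0) = cos(π/2L) > 0 for L ≥ 2).
* §3 `pathIneq_le_cos` — **`PathIneq L κ → κ ≤ L(2 − 2cos(π/L))`** (L ≥ 2); `two_sub_two_cos_eq` rewrites the bound
  as 4L sin²(π/(2L)); `sin_bound_lt_pi_sq_div` — 4L sin²(π/(2L)) < π²/L (sin x < x).
* §4 in every dimension d ≥ 2 (via `B6LayerTensor.layerIneq_iff_pathIneq`, `B6LayerOptimal`):
  `layerIneq_le_sin` (**`LayerIneq d L κ → κ ≤ 4L sin²(π/(2L))`**), `not_layerIneq_of_sin_lt`,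
  **`kappaOpt_le_sin`**, **`kappaOpt_lt_pi_sq_div`** (κ_opt(L) < π²/L), `sharp_window` (L ≥ 8:
  8/L ≤ κ_opt ≤ 4L sin²(π/(2L)) < π²/L), and two by-products: `pi_sq_div_lt_one` (π²/L < 1 for L ≥ 10, so
  `kappaOpt_lt_pi_sq_div` re-proves `B6LayerOptimal.kappaOpt_lt_one` — the printed factor 1 fails for every
  L ≥ 10 — by the eigenfunction route, independently of `B6LayerRayleigh`) and `one_le_sin_bound_of_le_nine` — the trigonometric inequality 1 ≤ 4L sin²(π/(2L)) for 2 ≤ L ≤ 9, read off from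
  `kappaOpt = 1` there (`B6LayerOptimal.kappaOpt_eq_one_iff`).

So no constant larger than κ_L := 4L sin²(π/(2L)) can replace the printed factor 1 for L ≥ 10 — the value named in
the package's written repair of Lemma 2.4 (seat b06, `Lemma24-repair.md`, census G-B6-10) is an upper bound for every
admissible layer constant, in every dimension.

## HONEST SCOPE

Nothing printed is asserted.  Only the UPPER bound κ_opt(L) ≤ 4L sin²(π/(2L)) is proved; the matching lower bound
(that 4L sin²(π/(2L)) itself is admissible, i.e. the full spectral decomposition of the path) is not attempted, so the
kernel window is [8/L, 4L sin²(π/(2L))] (ratio → π²/8).  Nothing is said about the constant of (2.128) (census G-B6-09R).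
-/

namespace Literature.MathematicalPhysics.QuantumFieldTheory.Balaban1983to89.B6LayerCosine

open Finset Real
open B6Lemma24Kappa (LayerIneq)
open B6LayerDimTwo (PathIneq)
open B6LayerTensor (layerIneq_iff_pathIneq)
open B6LayerUpperBound (sum_Ico_int_eq_sum_range)
open B6LayerWindow (bond_sum_eq layerIneq_eight_div)
open B6LayerOptimal (kappaOpt kappaOpt_mem kappaOpt_eq_one_iff layerIneq_iff_le)

variable {d L : ℕ}

/-! ## §1  A discrete Green identity for eigen-profiles of the free-boundary path -/

/-- If u(a−1) + u(a+1) = c·u(a) for every a and the ghost values reflect, u(−1) = u(0) and u(M+1) = u(M), then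
Σ_{s<M} (u(s+1) − u(s))² = (2 − c)·Σ_{s≤M} u(s)². [folklore] -/
theorem dirichlet_eq_of_eigen (M : ℕ) (u : ℤ → ℝ) (c : ℝ)
    (heig : ∀ a : ℤ, u (a - 1) + u (a + 1) = c * u a) (h0 : u (-1) = u 0) (hM : u ((M : ℤ) + 1) = u M) :
    ∑ s ∈ range M, (u ((s : ℤ) + 1) - u s) ^ 2 = (2 - c) * ∑ s ∈ range (M + 1), u s ^ 2 := by
  set P := ∑ s ∈ range M, u s * u ((s : ℤ) + 1) with hP
  set S := ∑ s ∈ range (M + 1), u s ^ 2 with hS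
  have e1 : ∑ s ∈ range M, u ((s : ℤ) + 1) ^ 2 = S - u 0 ^ 2 := by
    rw [hS, sum_range_succ']
    push_cast
    ring
  have e2 : ∑ s ∈ range M, u (s : ℤ) ^ 2 = S - u M ^ 2 := by
    rw [hS, sum_range_succ]
    ring
  have h1 : ∑ s ∈ range M, (u ((s : ℤ) + 1) - u s) ^ 2 = (S - u 0 ^ 2) + (S - u M ^ 2) - 2 * P := by
    rw [← e1, ← e2, hP, mul_sum, ← sum_add_distrib, ← sum_sub_distrib]
    exact sum_congr rfl fun s _ => by ring
  have e3 : c * S = ∑ s ∈ range (M + 1), (u s * u ((s : ℤ) - 1) + u s * u ((s : ℤ) + 1)) := by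
    rw [hS, mul_sum]
    exact sum_congr rfl fun s _ => by rw [← mul_add, heig]; ring
  have e4 : ∑ s ∈ range (M + 1), u s * u ((s : ℤ) + 1) = P + u M ^ 2 := by
    rw [sum_range_succ, hM, hP]
    ring
  have e5 : ∑ s ∈ range (M + 1), u s * u ((s : ℤ) - 1) = u 0 ^ 2 + P := by
    rw [sum_range_succ', hP]
    have key : ∀ k ∈ range M, u ((k + 1 : ℕ) : ℤ) * u (((k + 1 : ℕ) : ℤ) - 1) = u k * u ((k : ℤ) + 1) := by
      intro k _
      push_cast
      rw [add_sub_cancel_right, mul_comm]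
    rw [sum_congr rfl key]
    push_cast
    rw [h0]
    ring
  have h2 : c * S = 2 * P + u 0 ^ 2 + u M ^ 2 := by
    rw [e3, sum_add_distrib, e4, e5]
    ring
  rw [h1]
  linear_combination h2

/-! ## §2  The cosine profile u(a) = cos(π(2a+1)/(2L)) -/

/-- The lowest non-constant Neumann mode of the path [0, L): u(a) = cos(π(2a+1)/(2L)). [folklore] -/
noncomputable def cosTest (L : ℕ) (a : ℤ) : ℝ := cos (π * (2 * a + 1) / (2 * L))

/-- The discrete eigen-relation u(a−1) + u(a+1) = 2cos(π/L)·u(a), for every integer a. [folklore] -/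
theorem cosTest_eigen (hL : 1 ≤ L) (a : ℤ) :
    cosTest L (a - 1) + cosTest L (a + 1) = 2 * cos (π / L) * cosTest L a := by
  unfold cosTest
  have hL0 : (L : ℝ) ≠ 0 := by positivity
  have e1 : π * (2 * ((a - 1 : ℤ) : ℝ) + 1) / (2 * L) = π * (2 * a + 1) / (2 * L) - π / L := by
    push_cast
    field_simp
    ring
  have e2 : π * (2 * ((a + 1 : ℤ) : ℝ) + 1) / (2 * L) = π * (2 * a + 1) / (2 * L) + π / L := by
    push_cast
    field_simp
    ring
  rw [e1, e2, cos_sub, cos_add]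
  ring

/-- Left ghost value: u(−1) = u(0). [folklore] -/
theorem cosTest_ghost_left (L : ℕ) : cosTest L (-1) = cosTest L 0 := by
  unfold cosTest
  have e : π * (2 * ((-1 : ℤ) : ℝ) + 1) / (2 * L) = -(π * (2 * ((0 : ℤ) : ℝ) + 1) / (2 * L)) := by
    push_cast
    ring
  rw [e, cos_neg]

/-- Right ghost value: u(L) = u(L−1). [folklore] -/
theorem cosTest_ghost_right (hL : 1 ≤ L) : cosTest L L = cosTest L ((L : ℤ) - 1) := by
  unfold cosTest
  have hL0 : (L : ℝ) ≠ 0 := by positivity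
  have e1 : π * (2 * ((L : ℤ) : ℝ) + 1) / (2 * L) = π / (2 * L) + π := by
    push_cast
    field_simp
    ring
  have e2 : π * (2 * (((L : ℤ) - 1 : ℤ) : ℝ) + 1) / (2 * L) = π - π / (2 * L) := by
    push_cast
    field_simp
    ring
  rw [e1, e2, cos_add_pi, cos_pi_sub]

/-- Antisymmetry under the reflection a ↦ L − 1 − a: u(L−1−a) = −u(a). [folklore] -/
theorem cosTest_reflect (hL : 1 ≤ L) (a : ℤ) : cosTest L ((L : ℤ) - 1 - a) = -cosTest L a := by
  unfold cosTest
  have hL0 : (L : ℝ) ≠ 0 := by positivity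
  have e : π * (2 * (((L : ℤ) - 1 - a : ℤ) : ℝ) + 1) / (2 * L) = π - π * (2 * a + 1) / (2 * L) := by
    push_cast
    field_simp
    ring
  rw [e, cos_pi_sub]

/-- Hence Σ_{[0,L)} u = 0 (pair a with L − 1 − a; no trigonometric sum formula needed). [folklore] -/
theorem sum_cosTest (hL : 1 ≤ L) : ∑ a ∈ Ico (0 : ℤ) (L : ℤ), cosTest L a = 0 := by
  rw [sum_Ico_int_eq_sum_range]
  have h : ∑ j ∈ range L, cosTest L ((L - 1 - j : ℕ) : ℤ) = ∑ j ∈ range L, cosTest L (j : ℤ) :=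
    sum_range_reflect (fun n => cosTest L (n : ℤ)) L
  have h' : ∑ j ∈ range L, cosTest L ((L - 1 - j : ℕ) : ℤ) = -∑ j ∈ range L, cosTest L (j : ℤ) := by
    rw [← sum_neg_distrib]
    refine sum_congr rfl fun j hj => ?_
    have hj' := mem_range.1 hj
    rw [show ((L - 1 - j : ℕ) : ℤ) = (L : ℤ) - 1 - j by omega]
    exact cosTest_reflect hL j
  linarith

/-- u(0) = cos(π/(2L)) > 0 for L ≥ 2. [folklore] -/
theorem cosTest_zero_pos (hL : 2 ≤ L) : 0 < cosTest L 0 := by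
  unfold cosTest
  have hL' : (2 : ℝ) ≤ L := by exact_mod_cast hL
  apply cos_pos_of_mem_Ioo
  constructor
  · have : 0 < π * (2 * ((0 : ℤ) : ℝ) + 1) / (2 * L) := by push_cast; positivity
    linarith [pi_pos]
  · push_cast
    rw [div_lt_div_iff₀ (by positivity) (by positivity)]
    nlinarith [pi_pos]

/-! ## §3  The path inequality forces κ ≤ L(2 − 2cos(π/L)) = 4L sin²(π/(2L)) -/

/-- **`PathIneq L κ → κ ≤ L(2 − 2cos(π/L))`** for L ≥ 2: test the path inequality with `cosTest`. [folklore] -/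
theorem pathIneq_le_cos (hL : 2 ≤ L) {κ : ℝ} (h : PathIneq L κ) : κ ≤ (L : ℝ) * (2 - 2 * cos (π / L)) := by
  have hL1 : 1 ≤ L := by omega
  obtain ⟨M, rfl⟩ : ∃ M, L = M + 1 := ⟨L - 1, by omega⟩
  have key := h (cosTest (M + 1))
  rw [sum_cosTest hL1, bond_sum_eq hL1, sum_Ico_int_eq_sum_range, show M + 1 - 1 = M from rfl] at key
  have hg : cosTest (M + 1) ((M : ℤ) + 1) = cosTest (M + 1) M := by
    have := cosTest_ghost_right hL1
    push_cast at this
    rwa [add_sub_cancel_right] at this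
  rw [dirichlet_eq_of_eigen M (cosTest (M + 1)) (2 * cos (π / (M + 1 : ℕ))) (cosTest_eigen hL1)
    (cosTest_ghost_left (M + 1)) hg] at key
  have hS : 0 < ∑ s ∈ range (M + 1), cosTest (M + 1) s ^ 2 := by
    have h0 : cosTest (M + 1) ((0 : ℕ) : ℤ) ^ 2 ≤ ∑ s ∈ range (M + 1), cosTest (M + 1) s ^ 2 :=
      single_le_sum (f := fun s : ℕ => cosTest (M + 1) s ^ 2) (fun s _ => sq_nonneg _)
        (mem_range.2 (by omega))
    have h1 := cosTest_zero_pos hL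
    push_cast at h0
    nlinarith
  refine le_of_mul_le_mul_right (key.trans_eq ?_) hS
  ring

/-- 2 − 2cos(π/L) = 4 sin²(π/(2L)). [folklore] -/
theorem two_sub_two_cos_eq (hL : 1 ≤ L) : (L : ℝ) * (2 - 2 * cos (π / L)) = 4 * L * sin (π / (2 * L)) ^ 2 := by
  have hL0 : (L : ℝ) ≠ 0 := by positivity
  have e : π / L = 2 * (π / (2 * L)) := by
    field_simp
  rw [e, sin_sq_eq_half_sub]
  ring

/-- **`PathIneq L κ → κ ≤ 4L sin²(π/(2L))`** (L ≥ 2). [folklore] -/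
theorem pathIneq_le_sin (hL : 2 ≤ L) {κ : ℝ} (h : PathIneq L κ) : κ ≤ 4 * L * sin (π / (2 * L)) ^ 2 := by
  rw [← two_sub_two_cos_eq (by omega)]
  exact pathIneq_le_cos hL h

/-- 4L sin²(π/(2L)) < π²/L (L ≥ 1), from sin x < x. [folklore] -/
theorem sin_bound_lt_pi_sq_div (hL : 1 ≤ L) : 4 * L * sin (π / (2 * L)) ^ 2 < π ^ 2 / L := by
  have hL0 : (0 : ℝ) < L := by exact_mod_cast hL
  have hx : 0 < π / (2 * L) := by positivity
  have hL1 : (1 : ℝ) ≤ L := by exact_mod_cast hL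
  have hxπ : π / (2 * L) < π := by
    rw [div_lt_iff₀ (by positivity)]
    nlinarith [pi_pos]
  have h1 : sin (π / (2 * L)) < π / (2 * L) := sin_lt hx
  have h2 : 0 < sin (π / (2 * L)) := sin_pos_of_pos_of_lt_pi hx hxπ
  have h3 : sin (π / (2 * L)) ^ 2 < (π / (2 * L)) ^ 2 := by nlinarith
  calc 4 * L * sin (π / (2 * L)) ^ 2 < 4 * L * (π / (2 * L)) ^ 2 :=
        mul_lt_mul_of_pos_left h3 (by positivity)
    _ = π ^ 2 / L := by
        field_simp
        ring

/-! ## §4  In every dimension: the sharp upper end of the window -/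

/-- **`LayerIneq d L κ → κ ≤ 4L sin²(π/(2L))`** for every d ≥ 2, L ≥ 2. [folklore] -/
theorem layerIneq_le_sin (hd : 2 ≤ d) (hL : 2 ≤ L) {κ : ℝ} (h : LayerIneq d L κ) :
    κ ≤ 4 * L * sin (π / (2 * L)) ^ 2 :=
  pathIneq_le_sin hL ((layerIneq_iff_pathIneq hd (by omega) κ).1 h)

/-- No constant above 4L sin²(π/(2L)) is admissible, in any dimension d ≥ 2. [folklore] -/
theorem not_layerIneq_of_sin_lt (hd : 2 ≤ d) (hL : 2 ≤ L) {κ : ℝ} (hκ : 4 * L * sin (π / (2 * L)) ^ 2 < κ) :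
    ¬ LayerIneq d L κ :=
  fun h => lt_irrefl _ (hκ.trans_le (layerIneq_le_sin hd hL h))

/-- **κ_opt(L) ≤ 4L sin²(π/(2L))** (d ≥ 2, L ≥ 2). [folklore] -/
theorem kappaOpt_le_sin (hd : 2 ≤ d) (hL : 2 ≤ L) : kappaOpt d L ≤ 4 * L * sin (π / (2 * L)) ^ 2 :=
  layerIneq_le_sin hd hL (kappaOpt_mem hd (by omega))

/-- **κ_opt(L) < π²/L** (d ≥ 2, L ≥ 2). [folklore] -/
theorem kappaOpt_lt_pi_sq_div (hd : 2 ≤ d) (hL : 2 ≤ L) : kappaOpt d L < π ^ 2 / L :=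
  (kappaOpt_le_sin hd hL).trans_lt (sin_bound_lt_pi_sq_div (by omega))

/-- π²/L < 1 for L ≥ 10 (π < 3.15): so `kappaOpt_lt_pi_sq_div` re-proves, by the eigenfunction route and
independently of `B6LayerRayleigh`, that the printed factor 1 fails for every L ≥ 10 in every d ≥ 2
(`B6LayerOptimal.kappaOpt_lt_one`, not restated here). [folklore] -/
theorem pi_sq_div_lt_one (hL : 10 ≤ L) : π ^ 2 / (L : ℝ) < 1 := by
  have hL' : (10 : ℝ) ≤ L := by exact_mod_cast hL
  rw [div_lt_one (by positivity)]
  nlinarith [pi_lt_d2, pi_pos]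

/-- By-product: the trigonometric inequality 1 ≤ 4L sin²(π/(2L)) for 2 ≤ L ≤ 9, read off from κ_opt = 1 there
(`B6LayerOptimal.kappaOpt_eq_one_iff`) and `kappaOpt_le_sin`. [folklore] -/
theorem one_le_sin_bound_of_le_nine (hL : 2 ≤ L) (hL9 : L ≤ 9) : 1 ≤ 4 * L * sin (π / (2 * L)) ^ 2 := by
  have h := kappaOpt_le_sin (d := 2) le_rfl hL
  rwa [(kappaOpt_eq_one_iff (d := 2) le_rfl (by omega)).2 hL9] at h

/-- **The sharp window** (d ≥ 2, L ≥ 8): 8/L ≤ κ_opt(L) ≤ 4L sin²(π/(2L)) < π²/L. [folklore] -/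
theorem sharp_window (hd : 2 ≤ d) (hL : 8 ≤ L) :
    8 / (L : ℝ) ≤ kappaOpt d L ∧ kappaOpt d L ≤ 4 * L * sin (π / (2 * L)) ^ 2 ∧
      4 * L * sin (π / (2 * L)) ^ 2 < π ^ 2 / L :=
  ⟨(layerIneq_iff_le hd (by omega)).1 (layerIneq_eight_div hd hL), kappaOpt_le_sin hd (by omega),
    sin_bound_lt_pi_sq_div (by omega)⟩

end Literature.MathematicalPhysics.QuantumFieldTheory.Balaban1983to89.B6LayerCosine
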